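/-
Origin: expansion seat `planner-pub-hodgecm-toy2-g2-0`, handover 2026-08-18 (`HOME/pub-hodgecm-toy2-g2/lean/Toy2g2/Sextic.lean`, md5 d873228a, 179 lines);
landed by the gen-6 packager in gate run 22 as `HodgeCM/Model/SexticCM/Sextic.lean` (import ^import Toy2g2\.→import HodgeCM.Model.SexticCM. ×1).
-/
/-
Copyright: pub-hodgecm formalisation cell (harness21, 2026). New file (not vendored).
Origin: HOME/pub-hodgecm-toy2-g2/lean/Toy2g2/Sextic.lean (WIP module `Toy2g2.Sextic`; intended final place
`HodgeCM/Model/SexticCM/Sextic.lean` = module `HodgeCM.Model.SexticCM.Sextic`, CONTRIBUTING §3 L5) (seat planner-pub-hodgecm-toy2-g2-0,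
consistency seat 2 gen 2, part (6a)(ii): PerL's hypotheses are inhabited — the sextic m_kappa = X^6+6X^4+8X^2+1, K = Q(delta_0) subset C, [K:Q] = 6, minpoly).
-/
import Summits.HodgeConjecture.HodgeCM.Model.SexticCM.Cubic

open Polynomial IntermediateField NumberField

noncomputable section

namespace HodgeCM.SexticCM

/-! ## Layer 3: the sextic `m_κ = x⁶ + 6x⁴ + 8x² + 1` and `K = ℚ(δ₀)` -/

/-- `m_κ` -/
def mκ : ℚ[X] := X ^ 6 + 6 * X ^ 4 + 8 * X ^ 2 + 1

/-- (Ported verbatim from the HodgeCMPerL package; no docstring in the source.) -/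
lemma mκ_natDegree : mκ.natDegree = 6 := by unfold mκ; compute_degree!

/-- (Ported verbatim from the HodgeCMPerL package; no docstring in the source.) -/
lemma mκ_monic : mκ.Monic := by unfold mκ; monicity!

/-- (Ported verbatim from the HodgeCMPerL package; no docstring in the source.) -/
lemma aeval_mκ (x : ℂ) : aeval x mκ = x ^ 6 + 6 * x ^ 4 + 8 * x ^ 2 + 1 := by
  simp [mκ, map_ofNat]

/-- Vieta in `ℂ` -/
lemma vietaC : ((α 0 : ℝ) : ℂ) + (α 1 : ℝ) + (α 2 : ℝ) = 0 ∧
    ((α 0 : ℝ) : ℂ) * (α 1 : ℝ) + (α 0 : ℝ) * (α 2 : ℝ) + (α 1 : ℝ) * (α 2 : ℝ) = -4 ∧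
    ((α 0 : ℝ) : ℂ) * (α 1 : ℝ) * (α 2 : ℝ) = -1 := by
  obtain ⟨h1, h2, h3⟩ := vieta
  refine ⟨by exact_mod_cast h1, by exact_mod_cast h2, by exact_mod_cast h3⟩

/-- (Ported verbatim from the HodgeCMPerL package; no docstring in the source.) -/
lemma prod_form (x : ℂ) :
    x ^ 6 + 6 * x ^ 4 + 8 * x ^ 2 + 1 = ((x - δ 0) * (x + δ 0)) * ((x - δ 1) * (x + δ 1)) * ((x - δ 2) * (x + δ 2)) := by
  have e : ∀ k, (x - δ k) * (x + δ k) = x ^ 2 + 2 - ((α k : ℝ) : ℂ) := fun k => by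
    have := δ_sq k; linear_combination (-1 : ℂ) * this
  rw [e 0, e 1, e 2]
  obtain ⟨h1, h2, h3⟩ := vietaC
  linear_combination (x ^ 2 + 2) ^ 2 * h1 - (x ^ 2 + 2) * h2 + h3

/-- (Ported verbatim from the HodgeCMPerL package; no docstring in the source.) -/
lemma aeval_mκ_eq_zero_iff (x : ℂ) : aeval x mκ = 0 ↔ ∃ k, x = δ k ∨ x = -δ k := by
  rw [aeval_mκ, prod_form]
  simp only [mul_eq_zero, sub_eq_zero, add_eq_zero_iff_eq_neg]
  constructor
  · rintro (((h | h) | (h | h)) | (h | h))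
    exacts [⟨0, .inl h⟩, ⟨0, .inr h⟩, ⟨1, .inl h⟩, ⟨1, .inr h⟩, ⟨2, .inl h⟩, ⟨2, .inr h⟩]
  · rintro ⟨k, h | h⟩ <;> fin_cases k <;> simp_all

/-- (Ported verbatim from the HodgeCMPerL package; no docstring in the source.) -/
lemma aeval_δ (k : Fin 3) : aeval (δ k) mκ = 0 := (aeval_mκ_eq_zero_iff _).mpr ⟨k, .inl rfl⟩

/-- (Ported verbatim from the HodgeCMPerL package; no docstring in the source.) -/
lemma aeval_neg_δ (k : Fin 3) : aeval (-δ k) mκ = 0 := (aeval_mκ_eq_zero_iff _).mpr ⟨k, .inr rfl⟩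

/-- (Ported verbatim from the HodgeCMPerL package; no docstring in the source.) -/
lemma isIntegral_δ (k : Fin 3) : IsIntegral ℚ (δ k) := ⟨mκ, mκ_monic, by simpa [aeval_def] using aeval_δ k⟩

/-- (Ported verbatim from the HodgeCMPerL package; no docstring in the source.) -/
lemma mκ_ne_zero : mκ ≠ 0 := mκ_monic.ne_zero

/-- (Ported verbatim from the HodgeCMPerL package; no docstring in the source.) -/
lemma mem_rootSet_iff (x : ℂ) : x ∈ mκ.rootSet ℂ ↔ ∃ k, x = δ k ∨ x = -δ k := by
  rw [mem_rootSet_of_ne mκ_ne_zero, aeval_mκ_eq_zero_iff]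

/-- The sextic CM field `K = ℚ(δ₀) ⊂ ℂ`. -/
def K : IntermediateField ℚ ℂ := ℚ⟮δ 0⟯

/-- (Ported verbatim from the HodgeCMPerL package; no docstring in the source.) -/
lemma δ0_mem_K : δ 0 ∈ K := mem_adjoin_simple_self ℚ (δ 0)

/-- `b = β₀ = 2 - α₀ = -δ₀² ∈ K` -/
lemma b_eq : ((β 0 : ℝ) : ℂ) = -(δ 0) ^ 2 := by rw [δ_sq]; unfold β; push_cast; ring

/-- (Ported verbatim from the HodgeCMPerL package; no docstring in the source.) -/
lemma b_mem_K : ((β 0 : ℝ) : ℂ) ∈ K := by rw [b_eq]; exact neg_mem (pow_mem δ0_mem_K 2)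

/-! ### The cubic field `ℚ(b)`, `[ℚ(b):ℚ] = 3` -/

/-- (Ported verbatim from the HodgeCMPerL package; no docstring in the source.) -/
def g3ℤ : ℤ[X] := X ^ 3 - 6 * X ^ 2 + 8 * X - 1

/-- (Ported verbatim from the HodgeCMPerL package; no docstring in the source.) -/
def g3 : ℚ[X] := X ^ 3 - 6 * X ^ 2 + 8 * X - 1

/-- (Ported verbatim from the HodgeCMPerL package; no docstring in the source.) -/
lemma g3_map : g3ℤ.map (Int.castRingHom ℚ) = g3 := by simp [g3ℤ, g3]

/-- (Ported verbatim from the HodgeCMPerL package; no docstring in the source.) -/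
lemma g3ℤ_monic : g3ℤ.Monic := by unfold g3ℤ; monicity!

/-- (Ported verbatim from the HodgeCMPerL package; no docstring in the source.) -/
lemma g3_monic : g3.Monic := by unfold g3; monicity!

/-- (Ported verbatim from the HodgeCMPerL package; no docstring in the source.) -/
lemma g3_natDegree : g3.natDegree = 3 := by unfold g3; compute_degree!

/-- `g3 mod 3 = X³ + 2X + 2` has no root in `𝔽₃`, hence is irreducible. -/
def g3mod : (ZMod 3)[X] := X ^ 3 + 2 * X + 2

/-- (Ported verbatim from the HodgeCMPerL package; no docstring in the source.) -/
lemma g3mod_eq : g3ℤ.map (Int.castRingHom (ZMod 3)) = g3mod := by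
  have h3 : (3 : (ZMod 3)[X]) = 0 := by
    have : ((3 : ℕ) : (ZMod 3)[X]) = 0 := CharP.cast_eq_zero _ 3
    simpa using this
  have : g3ℤ = (X ^ 3 + 2 * X + 2) + 3 * (-2 * X ^ 2 + 2 * X - 1) := by unfold g3ℤ; ring
  rw [this]; simp [g3mod, h3]

/-- (Ported verbatim from the HodgeCMPerL package; no docstring in the source.) -/
lemma g3mod_monic : g3mod.Monic := by unfold g3mod; monicity!

/-- (Ported verbatim from the HodgeCMPerL package; no docstring in the source.) -/
lemma g3mod_natDegree : g3mod.natDegree = 3 := by unfold g3mod; compute_degree!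

/-- (Ported verbatim from the HodgeCMPerL package; no docstring in the source.) -/
lemma g3mod_irreducible : Irreducible g3mod := by
  refine (g3mod_monic.irreducible_iff_roots_eq_zero_of_degree_le_three
    (by norm_num [g3mod_natDegree]) (by norm_num [g3mod_natDegree])).mpr ?_
  refine Multiset.eq_zero_of_forall_notMem fun a ha => ?_
  rw [mem_roots g3mod_monic.ne_zero, IsRoot.def] at ha
  revert a; unfold g3mod; simp only [eval_add, eval_pow, eval_X, eval_mul, eval_ofNat]; decide

/-- (Ported verbatim from the HodgeCMPerL package; no docstring in the source.) -/
lemma g3_irreducible : Irreducible g3 := by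
  rw [← g3_map, ← IsPrimitive.Int.irreducible_iff_irreducible_map_cast g3ℤ_monic.isPrimitive]
  exact g3ℤ_monic.irreducible_of_irreducible_map _ _ (by rw [g3mod_eq]; exact g3mod_irreducible)

/-- (Ported verbatim from the HodgeCMPerL package; no docstring in the source.) -/
lemma aeval_b_g3 : aeval ((β 0 : ℝ) : ℂ) g3 = 0 := by
  have h := f3_α 0
  have hC : ((α 0 : ℝ) : ℂ) ^ 3 - 4 * (α 0 : ℝ) + 1 = 0 := by exact_mod_cast h
  simp only [g3, β, map_sub, map_add, map_mul, map_pow, aeval_X, map_one, map_ofNat, Complex.ofReal_sub,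
    Complex.ofReal_ofNat]
  linear_combination (-1 : ℂ) * hC

/-- (Ported verbatim from the HodgeCMPerL package; no docstring in the source.) -/
lemma minpoly_b : minpoly ℚ ((β 0 : ℝ) : ℂ) = g3 :=
  (minpoly.eq_of_irreducible_of_monic g3_irreducible aeval_b_g3 g3_monic).symm

/-- (Ported verbatim from the HodgeCMPerL package; no docstring in the source.) -/
lemma isIntegral_b : IsIntegral ℚ ((β 0 : ℝ) : ℂ) := ⟨g3, g3_monic, by simpa [aeval_def] using aeval_b_g3⟩

/-- (Ported verbatim from the HodgeCMPerL package; no docstring in the source.) -/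
lemma finrank_Qb : Module.finrank ℚ ℚ⟮((β 0 : ℝ) : ℂ)⟯ = 3 := by
  rw [adjoin.finrank isIntegral_b, minpoly_b, g3_natDegree]

/-- `ℚ(b)` consists of real numbers (fixed by conjugation). -/
lemma conj_eq_of_mem_Qb {x : ℂ} (hx : x ∈ ℚ⟮((β 0 : ℝ) : ℂ)⟯) : (starRingEnd ℂ) x = x := by
  -- the conj-fixed elements form an intermediate field containing b
  let S : IntermediateField ℚ ℂ :=
    { carrier := {x | (starRingEnd ℂ) x = x}
      mul_mem' := by intro a b ha hb; simp_all
      one_mem' := by simp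
      add_mem' := by intro a b ha hb; simp_all
      zero_mem' := by simp
      algebraMap_mem' := by intro q; simp
      inv_mem' := by intro a ha; simp_all }
  have : ℚ⟮((β 0 : ℝ) : ℂ)⟯ ≤ S := adjoin_simple_le_iff.mpr (by
    show (starRingEnd ℂ) _ = _; exact Complex.conj_ofReal _)
  exact this hx

/-- (Ported verbatim from the HodgeCMPerL package; no docstring in the source.) -/
lemma δ0_not_mem_Qb : δ 0 ∉ ℚ⟮((β 0 : ℝ) : ℂ)⟯ := fun h => by
  have := conj_eq_of_mem_Qb h
  rw [conj_δ] at this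
  exact δ_ne_neg 0 0 this.symm

/-! ### `[K:ℚ] = 6` -/

/-- (Ported verbatim from the HodgeCMPerL package; no docstring in the source.) -/
lemma Qb_le_K : ℚ⟮((β 0 : ℝ) : ℂ)⟯ ≤ K := adjoin_simple_le_iff.mpr b_mem_K

/-- (Ported verbatim from the HodgeCMPerL package; no docstring in the source.) -/
instance : FiniteDimensional ℚ K := adjoin.finiteDimensional (isIntegral_δ 0)

/-- (Ported verbatim from the HodgeCMPerL package; no docstring in the source.) -/
lemma minpoly_δ0_dvd : minpoly ℚ (δ 0) ∣ mκ := minpoly.dvd ℚ (δ 0) (aeval_δ 0)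

/-- (Ported verbatim from the HodgeCMPerL package; no docstring in the source.) -/
lemma finrank_K_le : Module.finrank ℚ K ≤ 6 := by
  rw [K, adjoin.finrank (isIntegral_δ 0), ← mκ_natDegree]
  exact natDegree_le_of_dvd minpoly_δ0_dvd mκ_ne_zero

/-- (Ported verbatim from the HodgeCMPerL package; no docstring in the source.) -/
lemma finrank_K : Module.finrank ℚ K = 6 := by
  obtain ⟨c, hc⟩ := finrank_dvd_of_le_right Qb_le_K
  rw [finrank_Qb] at hc
  have hpos : 0 < Module.finrank ℚ K := Module.finrank_pos
  have h6 := finrank_K_le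
  have hc' : c = 1 ∨ c = 2 := by omega
  rcases hc' with rfl | rfl
  · exfalso
    have : ℚ⟮((β 0 : ℝ) : ℂ)⟯ = K := eq_of_le_of_finrank_eq Qb_le_K (by rw [finrank_Qb, hc])
    exact δ0_not_mem_Qb (this ▸ δ0_mem_K)
  · omega

/-- (Ported verbatim from the HodgeCMPerL package; no docstring in the source.) -/
lemma minpoly_δ0 : minpoly ℚ (δ 0) = mκ := by
  refine (eq_of_monic_of_dvd_of_natDegree_le (minpoly.monic (isIntegral_δ 0)) mκ_monic
    minpoly_δ0_dvd ?_).symm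
  rw [mκ_natDegree, ← adjoin.finrank (isIntegral_δ 0)]
  exact finrank_K.ge

/-- (Ported verbatim from the HodgeCMPerL package; no docstring in the source.) -/
lemma mκ_irreducible : Irreducible mκ := minpoly_δ0 ▸ minpoly.irreducible (isIntegral_δ 0)

/-- (Ported verbatim from the HodgeCMPerL package; no docstring in the source.) -/
lemma mκ_separable : mκ.Separable := mκ_irreducible.separable

end HodgeCM.SexticCM
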